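import Summits.ABC.ABC.Theorems.IsogenyGlueCongruenceTorsionSharingLine
import HarnessLib

/-!
# Crux K `TorsionSharingPrimeBound` (stmt-ABC-2157), line `SketchIdeator3g2` — stub `stub_sameLevel`

The same-level piece `KSameLevel` of K (partner newform `g` of level `M = N = N_W`) from crux A
(`DegreePrimesPolyBounded`: the prime factors of the modular degree of some parametrisation datum
of a semistable `W` are `≤ C N^κ`) and the bundle of printed inputs `SameLevelCongruenceFacts`
((a) anemic congruence primes `ℓ ≥ 11`, `ℓ ∤ N` divide the congruence number `r_f`; (b) `0 < r_f`;
(c) the minimal degree divides every degree with the same newform; (d) ARS 2012 Thm 2.1,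
`ord_ℓ(r_f) = ord_ℓ(m_f)` for `ℓ² ∤ N`).

Proof: small `ℓ < 11` and `ℓ ∣ N` are absorbed by `κ' = max κ 1`, `C' = max C 11`; otherwise (a) and
(b) give `ℓ ∣ r_f ≠ 0`, a datum of minimal degree with the same newform exists (`Nat.find`), (d) at
that datum gives `ℓ ∣ m_min`, (c) gives `m_min ∣ deg D_A`, and A bounds `ℓ`.
-/

noncomputable section

-- `Summit.ABC.ABC` is the mandated summit-side namespace (single-conjunct summit).
set_option linter.dupNamespace false

open Literature.NumberTheory.EllipticCurves.ModularForms
open Summit.ABC.ABC.Theses.IsogenyGlueCongruence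
open scoped MatrixGroups ModularForm
open CongruenceSubgroup

namespace Summit.ABC.ABC.Theorems.IGCTorsionSharing

/-- Crux A and the printed same-level inputs give the same-level piece of K: a congruence prime
`ℓ` between `f_W` (`W` semistable of conductor `N`) and another newform of level `N` satisfies
`ℓ ≤ max(C, 11) · N^{max(κ, 1)}`. -/
theorem stub_sameLevel : DegreePrimesPolyBounded → SameLevelCongruenceFacts → KSameLevel := by
  intro hA hF
  obtain ⟨κ, C, hA⟩ := hA
  obtain ⟨hFa, hFb, hFc, hFd⟩ := hF
  refine ⟨max κ 1, max C 11, le_trans zero_le_one (le_max_right _ _), ?_⟩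
  intro W _ _ _ hW g hg hne ℓ hℓ hcong
  set κ' : ℝ := max κ 1
  set C' : ℝ := max C 11
  have hN1 : (1 : ℝ) ≤ (W.conductorNorm ℤ : ℝ) := by
    exact_mod_cast Nat.one_le_iff_ne_zero.2 (NeZero.ne _)
  have hκ'1 : (1 : ℝ) ≤ κ' := le_max_right _ _
  have hκκ' : κ ≤ κ' := le_max_left _ _
  have hC'11 : (11 : ℝ) ≤ C' := le_max_right _ _
  have hCC' : C ≤ C' := le_max_left _ _
  have hC'0 : (0 : ℝ) ≤ C' := by linarith
  have hNκ'1 : (1 : ℝ) ≤ (W.conductorNorm ℤ : ℝ) ^ κ' :=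
    Real.one_le_rpow hN1 (le_trans zero_le_one hκ'1)
  -- `ℓ < 11`
  by_cases hℓ11 : ℓ < 11
  · have h11 : (ℓ : ℝ) ≤ 11 := by exact_mod_cast hℓ11.le
    calc (ℓ : ℝ) ≤ 11 := h11
      _ ≤ C' := hC'11
      _ = C' * 1 := (mul_one C').symm
      _ ≤ C' * (W.conductorNorm ℤ : ℝ) ^ κ' := mul_le_mul_of_nonneg_left hNκ'1 hC'0
  push Not at hℓ11
  -- `ℓ ∣ N`
  by_cases hdiv : ℓ ∣ W.conductorNorm ℤ
  · have hle : (ℓ : ℝ) ≤ (W.conductorNorm ℤ : ℝ) := by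
      exact_mod_cast Nat.le_of_dvd (Nat.pos_of_ne_zero (NeZero.ne _)) hdiv
    calc (ℓ : ℝ) ≤ (W.conductorNorm ℤ : ℝ) := hle
      _ = (W.conductorNorm ℤ : ℝ) ^ (1 : ℝ) := (Real.rpow_one _).symm
      _ ≤ (W.conductorNorm ℤ : ℝ) ^ κ' := Real.rpow_le_rpow_of_exponent_le hN1 hκ'1
      _ = 1 * (W.conductorNorm ℤ : ℝ) ^ κ' := (one_mul _).symm
      _ ≤ C' * (W.conductorNorm ℤ : ℝ) ^ κ' :=
          mul_le_mul_of_nonneg_right (by linarith) (by positivity)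
  -- `ℓ ≥ 11`, `ℓ ∤ N`: the datum of crux A and the congruence number
  obtain ⟨D, hD⟩ := hA W hW
  have hdvd : ℓ ∣ congruenceNumber D.f := hFa W hW D g hg hne ℓ hℓ hℓ11 hdiv hcong
  have hr : 0 < congruenceNumber D.f := hFb W D
  -- a datum of minimal degree among all data (of all elliptic curves) with the newform `D.f`
  classical
  let P : ℕ → Prop := fun m => ∃ (W' : WeierstrassCurve ℚ) (_ : W'.IsElliptic)
    (D' : ModularParametrizationData W' (W.conductorNorm ℤ)), D'.f = D.f ∧ D'.modularDegree = m
  have hP : ∃ m, P m := ⟨D.modularDegree, W, ‹_›, D, rfl, rfl⟩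
  obtain ⟨W₀, inst₀, D₀, hf₀, hdeg₀⟩ : P (Nat.find hP) := Nat.find_spec hP
  have hmin : ∀ (W'' : WeierstrassCurve ℚ) [W''.IsElliptic]
      (D'' : ModularParametrizationData W'' (W.conductorNorm ℤ)),
      D''.f = D₀.f → D₀.modularDegree ≤ D''.modularDegree := by
    intro W'' _ D'' hf''
    rw [hdeg₀]
    exact Nat.find_min' hP ⟨W'', ‹_›, D'', hf''.trans hf₀, rfl⟩
  -- (d): `ord_ℓ(r_f) = ord_ℓ(deg D₀)` since `ℓ² ∤ N`
  have hsq : ¬ ℓ ^ 2 ∣ W.conductorNorm ℤ := fun h => hdiv ((dvd_pow_self ℓ two_ne_zero).trans h)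
  have hd : padicValNat ℓ (congruenceNumber D₀.f) = padicValNat ℓ D₀.modularDegree :=
    hFd W₀ (W.conductorNorm ℤ) D₀ hmin ℓ hℓ hsq
  rw [hf₀] at hd
  haveI : Fact ℓ.Prime := ⟨hℓ⟩
  have h1 : 1 ≤ padicValNat ℓ (congruenceNumber D.f) := one_le_padicValNat_of_dvd hr.ne' hdvd
  have hℓD₀ : ℓ ∣ D₀.modularDegree := dvd_of_one_le_padicValNat (hd ▸ h1)
  -- (c): the minimal degree divides `deg D`
  have hD₀D : D₀.modularDegree ∣ D.modularDegree := hFc (W.conductorNorm ℤ) W₀ W D₀ D hf₀.symm hmin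
  have hbound : (ℓ : ℝ) ≤ C * (W.conductorNorm ℤ : ℝ) ^ κ := hD ℓ hℓ (hℓD₀.trans hD₀D)
  calc (ℓ : ℝ) ≤ C * (W.conductorNorm ℤ : ℝ) ^ κ := hbound
    _ ≤ C' * (W.conductorNorm ℤ : ℝ) ^ κ := mul_le_mul_of_nonneg_right hCC' (by positivity)
    _ ≤ C' * (W.conductorNorm ℤ : ℝ) ^ κ' :=
        mul_le_mul_of_nonneg_left (Real.rpow_le_rpow_of_exponent_le hN1 hκκ') hC'0

end Summit.ABC.ABC.Theorems.IGCTorsionSharing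

end
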